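import Summits.BirchSwinnertonDyer.BirchSwinnertonDyer.Theorems.EisensteinDepletionAtTwoStarGO2SigmaStubKummerParityHom
import Literature.NumberTheory.EllipticCurves.ModularSymbolsParabolicCohomology
import Literature.NumberTheory.EllipticCurves.ManinConstantGamma1ModularDegree
import HarnessLib

/-!
# The parity group of a half-period (line `nsf`, crux `StarOptBNSF`, stmt-BirchSwinnertonDyer-27047): THEOREM A′ step (1) in the kernel

For a weight-`2` cusp form `f` on `Γ₀(N)`, a period pair `L` (lattice `Λ`), a scale `c ∈ ℚ` with
`c·Λ₁(f) ⊆ Λ` (`Λ₁(f) = periodLatticeGamma1 f`, the `Γ₁(N)`-period lattice) and `λ ∈ Λ` with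
`λ/2 ∉ Λ`, the **parity group**

  `Γ′_λ = {γ ∈ Γ₁(N) : c·{∞, γ∞}_f ∈ ℤλ + 2Λ}`

is the monodromy group of the double cover of `X₁(N)` classified by the `2`-torsion class of the
half-period `λ/2` of `ℂ/Λ` pushed to `J₁(N)` (cell memo HOME/p2/g33/THEOREM-A-v3.md, step (1): for
the `X₁(N)`-lattice-optimal curve `E₁ = ℂ/c·Λ₁(f)`, `χ_R(γ) = ⟨c{∞,γ∞}_f, λ⟩ mod 2`, and
`⟨v, λ⟩` is even iff `v ∈ ℤλ + 2Λ`).  To stay definition-free the group is handled through its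
membership predicate: a subgroup `Γ′ ≤ SL(2, ℤ)` with

  `γ ∈ Γ′ ↔ ∃ (hγ : γ ∈ Γ₀(N)), γ ∈ Γ₁(N) ∧ ∃ k : ℤ, ∃ w ∈ Λ, c·{∞, γ∞}_f = k·λ + 2w`      (★)

This file proves that such a `Γ′` EXISTS (`exists_parityGroup`: the parity set is a subgroup, by
Manin's additivity `cuspSymbol_mul_holds` and eng-2's index-`2` count `KummerStubs.halfLattice_add_iff`)
and has the three properties the congruence core
(`…DepletionAtTwo.CongruenceCore.false_of_antiinvariant_integral_cuspForm`, p639511) asks of `Γ′`: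

* `mem_of_trace_eq_two` — every element of `Γ₁(N)` of trace `2` (every unipotent) lies in `Γ′`: its
  period vanishes (tree `cuspSymbol_eq_zero_of_discr_eq_zero`), i.e. the cover is étale at every cusp;
* `exists_mem_gamma1_notMem` — `Γ′ ≠ Γ₁(N)` when moreover `c·Λ₁(f) = Λ` (the optimality / lattice
  clause of the line): the parity is a non-trivial character (`exists_mem_lattice_not_half`, eng-2's parity functional
  `KummerStubs.mem_halfLattice_iff_even`);
* `finiteIndex_of_parity` — `Γ′` has finite index in `SL(2, ℤ)` (index `≤ 2` in `Γ₁(N)`: kernel of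
  the parity character `Γ₁(N) → ℤ/2`).

With these, SKELETON v12 of line `nsf` pins the research stub's `Γ′` to `Γ′_λ`: what remains open is
exactly THEOREM A′ steps (2)–(3) («`X_{Γ′_λ}` carries a non-zero anti-invariant weight-`2` cusp form
with bounded denominators at `∞` when `λ/2` is a FORMAL rational `2`-torsion point»).
Nothing here reads `r_an`; StarOptBNSF / E1M_NSF / BSD are NOT proved by this file.
-/

set_option linter.dupNamespace false
set_option autoImplicit false

noncomputable section

open scoped MatrixGroups
open CongruenceSubgroup
open Literature.NumberTheory.EllipticCurves
open Literature.NumberTheory.EllipticCurves.ModularForms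

namespace Summit.BirchSwinnertonDyer.BirchSwinnertonDyer.Theorems.DepletionAtTwo.ParityGroup

variable {N : ℕ}

/-! ### `ℤλ + 2Λ` -/

/-- `ℤλ + 2Λ` is symmetric. [folklore] -/
theorem neg_mem_half {L : PeriodPair} {lam z : ℂ}
    (h : ∃ k : ℤ, ∃ w ∈ L.lattice, z = (k : ℂ) * lam + 2 * w) :
    ∃ k : ℤ, ∃ w ∈ L.lattice, -z = (k : ℂ) * lam + 2 * w := by
  obtain ⟨k, w, hw, rfl⟩ := h
  exact ⟨-k, -w, neg_mem hw, by push_cast; ring⟩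

/-- `0 ∈ ℤλ + 2Λ`. [folklore] -/
theorem zero_mem_half (L : PeriodPair) (lam : ℂ) :
    ∃ k : ℤ, ∃ w ∈ L.lattice, (0 : ℂ) = (k : ℂ) * lam + 2 * w :=
  ⟨0, 0, zero_mem _, by simp⟩

/-- `ℤλ + 2Λ ≠ Λ` for `λ ∈ Λ ∖ 2Λ`: one of the basis periods `ω₁, ω₂` has odd parity
(eng-2's parity functional `KummerStubs.mem_halfLattice_iff_even`). [folklore] -/
theorem exists_mem_lattice_not_half (L : PeriodPair) {lam : ℂ} (hlam : lam ∈ L.lattice)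
    (hlam2 : lam / 2 ∉ L.lattice) :
    ∃ z ∈ L.lattice, ¬ ∃ k : ℤ, ∃ w ∈ L.lattice, z = (k : ℂ) * lam + 2 * w := by
  obtain ⟨a, b, hab⟩ := PeriodPair.mem_lattice.mp hlam
  have hab' : ¬ (Even a ∧ Even b) := by
    rintro ⟨⟨s, hs⟩, ⟨t, ht⟩⟩
    apply hlam2
    refine PeriodPair.mem_lattice.mpr ⟨s, t, ?_⟩
    have hsC : (a : ℂ) = s + s := by exact_mod_cast hs
    have htC : (b : ℂ) = t + t := by exact_mod_cast ht
    rw [← hab, hsC, htC]; ring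
  by_cases hb : Even b
  · -- then `a` is odd and `ω₂` has odd parity
    have ha : ¬ Even a := fun ha ↦ hab' ⟨ha, hb⟩
    refine ⟨L.ω₂, L.ω₂_mem_lattice, fun h ↦ ha ?_⟩
    have h' : ∃ k : ℤ, ∃ w ∈ L.lattice,
        ((0 : ℤ) : ℂ) * L.ω₁ + ((1 : ℤ) : ℂ) * L.ω₂ = (k : ℂ) * (a * L.ω₁ + b * L.ω₂) + 2 * w := by
      obtain ⟨k, w, hw, e⟩ := h
      exact ⟨k, w, hw, by rw [hab]; push_cast; simpa using e⟩
    have := (KummerStubs.mem_halfLattice_iff_even L hab' 0 1).mp h'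
    simpa using this
  · refine ⟨L.ω₁, L.ω₁_mem_lattice, fun h ↦ hb ?_⟩
    have h' : ∃ k : ℤ, ∃ w ∈ L.lattice,
        ((1 : ℤ) : ℂ) * L.ω₁ + ((0 : ℤ) : ℂ) * L.ω₂ = (k : ℂ) * (a * L.ω₁ + b * L.ω₂) + 2 * w := by
      obtain ⟨k, w, hw, e⟩ := h
      exact ⟨k, w, hw, by rw [hab]; push_cast; simpa using e⟩
    have := (KummerStubs.mem_halfLattice_iff_even L hab' 1 0).mp h'
    simpa using this

/-- The period of an inverse: `{∞, γ⁻¹∞}_f = -{∞, γ∞}_f` (Manin's homomorphism `cuspSymbolHom`).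
[cite: Manin1972, Prop. 1.4 / Thm. 1.6] -/
theorem cuspSymbol_inv [NeZero N] (f : CuspForm (Gamma0 N) 2) (γ : Gamma0 N) :
    cuspSymbol f γ⁻¹ = -cuspSymbol f γ := by
  have h := map_inv (cuspSymbolHom f) γ
  rw [cuspSymbolHom_apply, cuspSymbolHom_apply, ← ofAdd_neg] at h
  exact Multiplicative.ofAdd.injective h

/-! ### Properties of a subgroup with the parity membership (★) that need no hypothesis -/

/-- A subgroup with membership (★) lies in `Γ₁(N)`. [folklore] -/
theorem le_gamma1_of_parity (f : CuspForm (Gamma0 N) 2) (L : PeriodPair) (c : ℚ) (lam : ℂ)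
    {Γ' : Subgroup SL(2, ℤ)}
    (hΓ : ∀ γ : SL(2, ℤ), γ ∈ Γ' ↔ ∃ hγ : γ ∈ Gamma0 N, γ ∈ Gamma1 N ∧
      ∃ k : ℤ, ∃ w ∈ L.lattice, (c : ℂ) * cuspSymbol f ⟨γ, hγ⟩ = (k : ℂ) * lam + 2 * w) :
    Γ' ≤ Gamma1 N := by
  intro γ hγ
  obtain ⟨-, hγ1, -⟩ := (hΓ γ).mp hγ
  exact hγ1

/-- **Étale at the cusps**: every element of `Γ₁(N)` of trace `2` (i.e. every unipotent element, every
stabiliser of a cusp) lies in a subgroup with membership (★), because its period `{∞, γ∞}_f`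
vanishes (tree `cuspSymbol_eq_zero_of_discr_eq_zero`). [cite: Knapp1993, Prop. 11.1] -/
theorem mem_of_trace_eq_two [NeZero N] (f : CuspForm (Gamma0 N) 2) (L : PeriodPair) (c : ℚ) (lam : ℂ)
    {Γ' : Subgroup SL(2, ℤ)}
    (hΓ : ∀ γ : SL(2, ℤ), γ ∈ Γ' ↔ ∃ hγ : γ ∈ Gamma0 N, γ ∈ Gamma1 N ∧
      ∃ k : ℤ, ∃ w ∈ L.lattice, (c : ℂ) * cuspSymbol f ⟨γ, hγ⟩ = (k : ℂ) * lam + 2 * w)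
    {γ : SL(2, ℤ)} (hγ1 : γ ∈ Gamma1 N) (htr : (γ : Matrix (Fin 2) (Fin 2) ℤ).trace = 2) :
    γ ∈ Γ' := by
  have hγ0 : γ ∈ Gamma0 N := Gamma1_in_Gamma0 N hγ1
  refine (hΓ γ).mpr ⟨hγ0, hγ1, ?_⟩
  have hdiscr : ((⟨γ, hγ0⟩ : Gamma0 N) : SL(2, ℤ)).val.discr = 0 := by
    change (γ : Matrix (Fin 2) (Fin 2) ℤ).discr = 0
    rw [Matrix.discr_fin_two, htr, Matrix.SpecialLinearGroup.det_coe]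
    norm_num
  rw [cuspSymbol_eq_zero_of_discr_eq_zero f hdiscr, mul_zero]
  exact zero_mem_half L lam

/-! ### Under the standing hypotheses `c·Λ₁(f) ⊆ Λ`, `λ ∈ Λ`, `λ/2 ∉ Λ` -/

section Hypotheses

variable [NeZero N] (f : CuspForm (Gamma0 N) 2) (L : PeriodPair) (c : ℚ) {lam : ℂ}
  (hin : ∀ z ∈ periodLatticeGamma1 f, (c : ℂ) * z ∈ L.lattice)
  (hlam : lam ∈ L.lattice) (hlam2 : lam / 2 ∉ L.lattice)

omit [NeZero N] in
include hin in
/-- `c·{∞, γ∞}_f ∈ Λ` for `γ ∈ Γ₁(N)`. [folklore] -/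
theorem smul_cuspSymbol_mem {γ : SL(2, ℤ)} (hγ0 : γ ∈ Gamma0 N) (hγ1 : γ ∈ Gamma1 N) :
    (c : ℂ) * cuspSymbol f ⟨γ, hγ0⟩ ∈ L.lattice :=
  hin _ (cuspSymbol_mem_periodLatticeGamma1 f ⟨γ, hγ1⟩)

include hin hlam hlam2 in
/-- **Multiplicativity of the parity** (eng-2's `stub_kummerParityHom`, here on `Γ₁(N)` with the
`Λ₁(f)`-scale `c`): for `γ, δ ∈ Γ₁(N)`, `c{∞,γδ∞} ∈ ℤλ + 2Λ ↔ (c{∞,γ∞} ∈ ℤλ + 2Λ ↔ c{∞,δ∞} ∈ ℤλ + 2Λ)`.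
[cite: Manin1972, Prop. 1.4 / Thm. 1.6] -/
theorem parity_mul_iff {γ δ : SL(2, ℤ)} (hγ0 : γ ∈ Gamma0 N) (hγ1 : γ ∈ Gamma1 N)
    (hδ0 : δ ∈ Gamma0 N) (hδ1 : δ ∈ Gamma1 N) :
    (∃ k : ℤ, ∃ w ∈ L.lattice,
        (c : ℂ) * cuspSymbol f ⟨γ * δ, mul_mem hγ0 hδ0⟩ = (k : ℂ) * lam + 2 * w) ↔
      ((∃ k : ℤ, ∃ w ∈ L.lattice, (c : ℂ) * cuspSymbol f ⟨γ, hγ0⟩ = (k : ℂ) * lam + 2 * w) ↔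
        (∃ k : ℤ, ∃ w ∈ L.lattice, (c : ℂ) * cuspSymbol f ⟨δ, hδ0⟩ = (k : ℂ) * lam + 2 * w)) := by
  have e : (⟨γ * δ, mul_mem hγ0 hδ0⟩ : Gamma0 N) = ⟨γ, hγ0⟩ * ⟨δ, hδ0⟩ := rfl
  rw [e, cuspSymbol_mul_holds f, mul_add]
  exact KummerStubs.halfLattice_add_iff L hlam hlam2 (smul_cuspSymbol_mem f L c hin hγ0 hγ1)
    (smul_cuspSymbol_mem f L c hin hδ0 hδ1)

include hin hlam hlam2 in
/-- **The parity group exists**: under the standing hypotheses the parity set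
`{γ ∈ Γ₁(N) : c·{∞, γ∞}_f ∈ ℤλ + 2Λ}` is a subgroup of `SL(2, ℤ)` (Manin's additivity + the
index-`2` count), so there is a subgroup `Γ′` with membership (★). [folklore] -/
theorem exists_parityGroup :
    ∃ Γ' : Subgroup SL(2, ℤ), ∀ γ : SL(2, ℤ), γ ∈ Γ' ↔ ∃ hγ : γ ∈ Gamma0 N, γ ∈ Gamma1 N ∧
      ∃ k : ℤ, ∃ w ∈ L.lattice, (c : ℂ) * cuspSymbol f ⟨γ, hγ⟩ = (k : ℂ) * lam + 2 * w := by
  refine ⟨{ carrier := {γ | ∃ hγ : γ ∈ Gamma0 N, γ ∈ Gamma1 N ∧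
              ∃ k : ℤ, ∃ w ∈ L.lattice, (c : ℂ) * cuspSymbol f ⟨γ, hγ⟩ = (k : ℂ) * lam + 2 * w}
            mul_mem' := fun {γ δ} hγ' hδ' ↦ ?_
            one_mem' := ?_
            inv_mem' := fun {γ} hγ' ↦ ?_ }, fun γ ↦ Iff.rfl⟩
  · obtain ⟨hγ0, hγ1, hγ⟩ := hγ'
    obtain ⟨hδ0, hδ1, hδ⟩ := hδ'
    exact ⟨mul_mem hγ0 hδ0, mul_mem hγ1 hδ1,
      (parity_mul_iff f L c hin hlam hlam2 hγ0 hγ1 hδ0 hδ1).mpr (iff_of_true hγ hδ)⟩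
  · refine ⟨one_mem _, one_mem _, ?_⟩
    have e : (⟨1, one_mem _⟩ : Gamma0 N) = 1 := rfl
    rw [e, cuspSymbol_one, mul_zero]
    exact zero_mem_half L lam
  · obtain ⟨hγ0, hγ1, hγ⟩ := hγ'
    refine ⟨inv_mem hγ0, inv_mem hγ1, ?_⟩
    have e : (⟨γ⁻¹, inv_mem hγ0⟩ : Gamma0 N) = ⟨γ, hγ0⟩⁻¹ := rfl
    rw [e, cuspSymbol_inv, mul_neg]
    exact neg_mem_half hγ

omit [NeZero N] in
include hin hlam hlam2 in
/-- **Properness**: if moreover `c·Λ₁(f) = Λ` (the `X₁(N)`-lattice-optimality clause) then a subgroup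
with membership (★) is not all of `Γ₁(N)` — some `γ₀ ∈ Γ₁(N)` has odd parity, since otherwise the
index-`2` subgroup `ℤλ + 2Λ` would contain the generators `c·{∞, γ∞}_f` of `Λ`
(`NsfReduction.halfLattice_not_all`). [folklore] -/
theorem exists_mem_gamma1_notMem {Γ' : Subgroup SL(2, ℤ)}
    (hΓ : ∀ γ : SL(2, ℤ), γ ∈ Γ' ↔ ∃ hγ : γ ∈ Gamma0 N, γ ∈ Gamma1 N ∧
      ∃ k : ℤ, ∃ w ∈ L.lattice, (c : ℂ) * cuspSymbol f ⟨γ, hγ⟩ = (k : ℂ) * lam + 2 * w)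
    (hout : ∀ z ∈ L.lattice, ∃ w ∈ periodLatticeGamma1 f, z = (c : ℂ) * w) :
    ∃ γ₀ ∈ Gamma1 N, γ₀ ∉ Γ' := by
  by_contra hall
  push Not at hall
  -- every generator has even parity, hence all of `c·Λ₁(f) = Λ`
  have hgen : ∀ w ∈ periodLatticeGamma1 f,
      ∃ k : ℤ, ∃ w' ∈ L.lattice, (c : ℂ) * w = (k : ℂ) * lam + 2 * w' := by
    intro w hw
    induction hw using AddSubgroup.closure_induction with
    | mem x hx =>
      obtain ⟨γ, rfl⟩ := hx
      obtain ⟨hγ0, -, hP⟩ := (hΓ _).mp (hall _ γ.2)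
      exact hP
    | zero => rw [mul_zero]; exact zero_mem_half L lam
    | add x y hx hy ihx ihy =>
      rw [mul_add]
      exact (KummerStubs.halfLattice_add_iff L hlam hlam2 (hin x hx) (hin y hy)).mpr
        (iff_of_true ihx ihy)
    | neg x hx ih => rw [mul_neg]; exact neg_mem_half ih
  obtain ⟨z, hz, hnot⟩ := exists_mem_lattice_not_half L hlam hlam2
  obtain ⟨w, hw, rfl⟩ := hout z hz
  exact hnot (hgen w hw)

include hin hlam hlam2 in
/-- **Finite index**: a subgroup with membership (★) is, inside `Γ₁(N)`, the kernel of the parity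
character `Γ₁(N) → ℤ/2`, so it has index `≤ 2` in `Γ₁(N)` and finite index in `SL(2, ℤ)`. [folklore] -/
theorem finiteIndex_of_parity {Γ' : Subgroup SL(2, ℤ)}
    (hΓ : ∀ γ : SL(2, ℤ), γ ∈ Γ' ↔ ∃ hγ : γ ∈ Gamma0 N, γ ∈ Gamma1 N ∧
      ∃ k : ℤ, ∃ w ∈ L.lattice, (c : ℂ) * cuspSymbol f ⟨γ, hγ⟩ = (k : ℂ) * lam + 2 * w) :
    Γ'.FiniteIndex := by
  classical
  -- the parity character on `Γ₁(N)`
  let P : Gamma1 N → Prop := fun γ ↦ ∃ k : ℤ, ∃ w ∈ L.lattice,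
    (c : ℂ) * cuspSymbol f ⟨(γ : SL(2, ℤ)), Gamma1_in_Gamma0 N γ.2⟩ = (k : ℂ) * lam + 2 * w
  have hPmul : ∀ γ δ : Gamma1 N, P (γ * δ) ↔ (P γ ↔ P δ) := fun γ δ ↦
    parity_mul_iff f L c hin hlam hlam2 (Gamma1_in_Gamma0 N γ.2) γ.2 (Gamma1_in_Gamma0 N δ.2) δ.2
  have hP1 : P 1 := by
    change ∃ k : ℤ, ∃ w ∈ L.lattice, (c : ℂ) * cuspSymbol f ⟨1, _⟩ = (k : ℂ) * lam + 2 * w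
    rw [show (⟨(1 : SL(2, ℤ)), Gamma1_in_Gamma0 N (1 : Gamma1 N).2⟩ : Gamma0 N) = 1 from rfl,
      cuspSymbol_one, mul_zero]
    exact zero_mem_half L lam
  let φ : Gamma1 N →* Multiplicative (ZMod 2) :=
    { toFun := fun γ ↦ if P γ then 1 else Multiplicative.ofAdd 1
      map_one' := by simp [hP1]
      map_mul' := by
        intro γ δ
        have h := hPmul γ δ
        by_cases hγ : P γ <;> by_cases hδ : P δ
        · simp [hγ, hδ, h.mpr (iff_of_true hγ hδ)]
        · have : ¬ P (γ * δ) := fun hm ↦ hδ ((h.mp hm).mp hγ)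
          simp [hγ, hδ, this]
        · have : ¬ P (γ * δ) := fun hm ↦ hγ ((h.mp hm).mpr hδ)
          simp [hγ, hδ, this]
        · have : P (γ * δ) := h.mpr (iff_of_false hγ hδ)
          simp only [hγ, hδ, this, if_true, if_false, ← ofAdd_add]
          rfl }
  -- its kernel is `Γ′ ∩ Γ₁(N)`
  have hker : Γ'.subgroupOf (Gamma1 N) = φ.ker := by
    ext γ
    rw [Subgroup.mem_subgroupOf, MonoidHom.mem_ker, hΓ]
    constructor
    · rintro ⟨hγ0, -, hP⟩
      have : P γ := hP
      simp [φ, this]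
    · intro h
      have hP : P γ := by
        by_contra hP
        have h1 : φ γ = Multiplicative.ofAdd 1 := by simp [φ, hP]
        rw [h] at h1
        exact absurd (Multiplicative.ofAdd.injective
          (show Multiplicative.ofAdd (0 : ZMod 2) = Multiplicative.ofAdd 1 from h1)) (by decide)
      exact ⟨Gamma1_in_Gamma0 N γ.2, γ.2, hP⟩
  have hrel : Γ'.relIndex (Gamma1 N) ≠ 0 := by
    change (Γ'.subgroupOf (Gamma1 N)).index ≠ 0
    rw [hker, Subgroup.index_ker]
    exact Nat.card_pos.ne'
  refine ⟨fun h0 ↦ ?_⟩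
  have hmul := Subgroup.relIndex_mul_index (le_gamma1_of_parity f L c lam hΓ)
  rw [h0, mul_eq_zero] at hmul
  rcases hmul with h | h
  · exact hrel h
  · exact (instFiniteIndexGamma1 N).index_ne_zero h

end Hypotheses

end Summit.BirchSwinnertonDyer.BirchSwinnertonDyer.Theorems.DepletionAtTwo.ParityGroup

end
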